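import Summits.KontsevichZagierPeriods.KontsevichZagierPeriods.Theorems.LinRedNormalFormArrangementNormalFormStubRebaseSimplePosOnePosParFlatDep

/-!
# Stub `stub_rebaseSimplePosOnePos` (crux `ArrangementNormalForm`, line `janus-bands`) —
part `QuadClose`: a charted flat cell is good (`B = 2`)

`B = 2` corner calculus: the output of the steep blow-up of a flat point (parts `QuadChart`,
`QuadForms`, `QuadMove`) is a parallel transverse band over a PRODUCT cell
`{(ρ, ξ)-rows} × (ylo(ξ), yhi(ξ))` in the base `(ρ, ξ, η)`, letter `0`, base pole `η = 0`
(or any `x'`-form), whose `η`-walls `ylo`, `yhi` and whose bounds `U < θ < V` do not involve the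
radial coordinate `ρ` (`hfree`). Such a datum is congruent modulo `KZ.relations` to the
subgroup generated by `GG 2 2 1` with NO residue (`RebasePos.good_rhoFreeCell`): the height
`yhi − ylo` and the width `V − U` are forms in `ξ` alone, so their linear parts are dependent
and a flat cell is closed by level splits (`RebasePos.good_parCell_of_flat_dep`, part
`ParFlatDep`), a cell without flat point by `RebasePos.good_parCell_of_noFlat` (part `Flats`).
Registered as `rebaseSimplePos_rhoFreeCell`.

References: M. Kontsevich, D. Zagier, *Periods* (2001), §1.2, rules (1a), (2).
-/

noncomputable section

open Set MeasureTheory MvPolynomial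
open Literature.NumberTheory.Transcendental Literature.ModelTheory.ExponentialFields

namespace Summit.KontsevichZagierPeriods.ArrangementNormalForm.JanusBands

namespace RebasePos

open SeparatePos

section QuadClose

variable {m m' m₀ : ℕ} (L : Fin m → (Fin 2 → ℚ) × ℚ) (e : Fin m → ℕ) (ℓ₁ ℓ₂ : (Fin 2 → ℚ) × ℚ)

/-- Two `x'`-forms over the silent plane `(ρ, ξ)` with vanishing `ρ`-coefficients have
dependent linear parts. -/
theorem dep_of_rhoFree (d d' : (Fin 2 → ℚ) × ℚ) (hd : d.1 0 = 0) (hd' : d'.1 0 = 0) :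
    ∃ c : ℚ, d.1 = c • d'.1 ∨ d'.1 = c • d.1 := by
  by_cases h : d'.1 1 = 0
  · refine ⟨0, Or.inr (funext fun i => ?_)⟩
    fin_cases i
    · simpa using hd'
    · simpa using h
  · refine ⟨d.1 1 / d'.1 1, Or.inl (funext fun i => ?_)⟩
    fin_cases i
    · simp [hd, hd']
    · simp only [Fin.mk_one, Pi.smul_apply, smul_eq_mul]
      field_simp

/-- **A `ρ`-free product cell is good** (`B = 2`). Data of `Hpar` (parallel transverse bands,
letter `0`, common slope `s ≠ 0`, base factor `P(ρ, ξ)/∏ Lⱼ(ρ, ξ)^{eⱼ} · 1/(η − ℓ₂(ρ, ξ))`)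
over a product cell `{(ρ, ξ)-rows M₀} × (ylo, yhi)` (`hsec`) whose `η`-walls and bounds have
vanishing `ρ`-coefficients (`hfree`): `[s] ∈ closure (GG 2 2 1)` modulo `KZ.relations`. -/
theorem good_rhoFreeCell (s : KZ.IntegralRep (2 + 1 + 1)) (M : Fin m' → (Fin (2 + 1) → ℚ) × ℚ)
    (M₀ : Fin m₀ → (Fin 2 → ℚ) × ℚ) (ylo yhi : (Fin 2 → ℚ) × ℚ) (p : MvPolynomial (Fin 2) ℚ)
    (u v : (Fin (2 + 1) → ℚ) × ℚ) (hbd : Bornology.IsBounded s.domain)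
    (hdom : s.domain = gDom 2 1 m' M (fun _ => Sum.inr u) (fun _ => Sum.inr v))
    (hint : EqOn s.integrand (glit 2 1 p L e ℓ₁ ℓ₂ 0 1 (fun _ => some 0)) s.domain)
    (hu : u.1 (Fin.last 2) ≠ 0) (hpar : u.1 (Fin.last 2) = v.1 (Fin.last 2))
    (hcell : ∀ z : Fin (2 + 1 + 1) → ℝ, (∀ j, 0 < affF 2 1 (M j) z) → 0 < affF 2 1 u z ∧ affF 2 1 u z < affF 2 1 v z)
    (hsec : ∀ z : Fin (2 + 1 + 1) → ℝ, (∀ j, 0 < affF 2 1 (M j) z) ↔ ((∀ j, 0 < affB 2 1 (M₀ j) z) ∧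
      affB 2 1 ylo z < z (Fin.castAdd 1 (Fin.last 2)) ∧ z (Fin.castAdd 1 (Fin.last 2)) < affB 2 1 yhi z))
    (hfree : ylo.1 0 = 0 ∧ yhi.1 0 = 0 ∧ u.1 0 = 0 ∧ v.1 0 = 0) :
    ∃ c ∈ AddSubgroup.closure (GGset 2 2 1), KZ.of s - c ∈ KZ.relations := by
  obtain ⟨hlo0, hhi0, hu0, hv0⟩ := hfree
  by_cases hfl : ∃ z ∈ closure {z : Fin (2 + 1 + 1) → ℝ | ∀ j, 0 < affF 2 1 (M j) z},
      affB 2 1 ylo z = affB 2 1 yhi z ∧ affF 2 1 u z = affF 2 1 v z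
  · refine good_parCell_of_flat_dep L e ℓ₁ ℓ₂ s M M₀ ylo yhi p u v hbd hdom hint hpar hcell hsec hfl ?_
    refine dep_of_rhoFree (yhi - ylo) (restr 2 v - restr 2 u) ?_ ?_
    · simp [hlo0, hhi0]
    · simp [restr, hu0, hv0]
  · push Not at hfl
    exact good_parCell_of_noFlat L e ℓ₁ ℓ₂ s M M₀ ylo yhi p u v hbd hdom hint hu hpar hcell hsec
      fun z hz h1 h2 => hfl z hz h1 h2

end QuadClose

end RebasePos

/-- **Registered part of `stub_rebaseSimplePosOnePos` (line `janus-bands`, `B = 2` corner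
calculus): a `ρ`-free product cell is good.** Parallel transverse bands (letter `0`, common
slope `s ≠ 0`, base factor `P(ρ, ξ)/∏ Lⱼ(ρ, ξ)^{eⱼ} · 1/(η − ℓ₂(ρ, ξ))`) over a product cell
`{(ρ, ξ)-rows M₀} × (ylo, yhi)` in the base `(ρ, ξ, η)` whose `η`-walls and bounds do not
involve `ρ` — the shape produced by the steep blow-up of a flat point — are congruent modulo
`KZ.relations` to the subgroup generated by `GG 2 2 1`: height and width are forms in `ξ`
alone, so a flat cell has dependent height and width (`rebaseSimplePos_par_flatDep`) and a
cell without flat point is `RebasePos.good_parCell_of_noFlat` (`RebasePos.good_rhoFreeCell`). -/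
theorem rebaseSimplePos_rhoFreeCell (m m' m₀ : ℕ) (s : KZ.IntegralRep (2 + 1 + 1)) (M : Fin m' → (Fin (2 + 1) → ℚ) × ℚ) (M₀ : Fin m₀ → (Fin 2 → ℚ) × ℚ) (ylo yhi : (Fin 2 → ℚ) × ℚ) (L : Fin m → (Fin 2 → ℚ) × ℚ) (e : Fin m → ℕ) (p : MvPolynomial (Fin 2) ℚ) (ℓ₁ ℓ₂ : (Fin 2 → ℚ) × ℚ) (u v : (Fin (2 + 1) → ℚ) × ℚ) (hbd : Bornology.IsBounded s.domain) (hdom : s.domain = SeparatePos.gDom 2 1 m' M (fun _ => Sum.inr u) (fun _ => Sum.inr v)) (hint : Set.EqOn s.integrand (RebasePos.glit 2 1 p L e ℓ₁ ℓ₂ 0 1 (fun _ => some 0)) s.domain) (hu : u.1 (Fin.last 2) ≠ 0) (hpar : u.1 (Fin.last 2) = v.1 (Fin.last 2)) (hcell : ∀ z : Fin (2 + 1 + 1) → ℝ, (∀ j, 0 < SeparatePos.affF 2 1 (M j) z) → 0 < SeparatePos.affF 2 1 u z ∧ SeparatePos.affF 2 1 u z < SeparatePos.affF 2 1 v z) (hsec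 : ∀ z : Fin (2 + 1 + 1) → ℝ, (∀ j, 0 < SeparatePos.affF 2 1 (M j) z) ↔ ((∀ j, 0 < SeparatePos.affB 2 1 (M₀ j) z) ∧ SeparatePos.affB 2 1 ylo z < z (Fin.castAdd 1 (Fin.last 2)) ∧ z (Fin.castAdd 1 (Fin.last 2)) < SeparatePos.affB 2 1 yhi z)) (hfree : ylo.1 0 = 0 ∧ yhi.1 0 = 0 ∧ u.1 0 = 0 ∧ v.1 0 = 0) : ∃ c ∈ AddSubgroup.closure (SeparatePos.GGset 2 2 1), KZ.of s - c ∈ KZ.relations :=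
  RebasePos.good_rhoFreeCell L e ℓ₁ ℓ₂ s M M₀ ylo yhi p u v hbd hdom hint hu hpar hcell hsec hfree

end Summit.KontsevichZagierPeriods.ArrangementNormalForm.JanusBands
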